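import Summits.Ventures.Crystal3D.Theorems.StickyWulffConstantCoaxialWallLawEndRowDefsA
import Literature.MathematicalPhysics.StatisticalMechanics.BarlowBilayers
import HarnessLib

/-!
# Definitions: the ON-SITE / TAIL decomposition of lane F's (A) census rows, by CLASS SIGNATURES

HONEST FRAMING. Venture `Summits/Ventures/Crystal3D` (cell `crystal3d-full`), crux `CoaxialWallLaw`
(stmt-Ventures-19481, `route-Ventures-StickyWulffConstant`), REGISTERED line `WallLedgerF` (planner cf-p1).  DEFINITIONS
ONLY; nothing is claimed here.  cf-p1 ORDER OF RECORD for 19481-p2 g8 (2026-08-28T21:28:15Z, item (2)) and the co-signed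
pre-registration HOME/cf-lit/fcert/PREREG-F-CERT.md (v0.3; 19481-p2 signature 21:58Z): the typed rows of record
`EndRowTransA v s_F` / `EndRowTwinHalfTurnA v s_F` (`…EndRowDefsA`; key `(v2(A), r = 1)`, `s_F* = 9/2`) are to be
discharged as ON-SITE(𝒰) + TAIL(𝒰) for a finite universe 𝒰 of payer windows (U-W: every Barlow stacking visible in the
closed ball `B̄(z, 3)`, `≤ v_max` vacancies), the on-site half by certified enumeration (lit g16 / cf-p2 g18–19, STEP-1/2:
max `1783/420 = 4.2452` through `|V| = 3`), the tail by theorem.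

THE TYPED OBJECTS.  A CLASS SIGNATURE is a pair `(ε, w)` — a side `ε : Bool` and a model slot `w` — realised as the
class with frame `sigFrame ε` (`false ↦` identity, slot dozen `D₊ = fccSlots`; `true ↦` the basal model mirror
`basalMirror`, slot dozen `D₋ =` the basal twin of `fccSlots`) and direction `sigFrame ε w`.
* `IsEndPairSig X v sig b q` — `(b, q)` is an (A)-end pair THROUGH ONE OF THE SIGNATURES of the finite set `Σ`
  (verbatim `IsEndPairA` with the admissible-class witness replaced by a signature); `endMultSig`, `localStatSig X v Σ z`
  (the summand of `LocalEndRowA` at the payer `z`);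
* the ROW SIGNATURE SETS: `transSigs ε n` for a model menu normal `n` — the six root classes of the slots of `D_ε` in
  the plane `sigFrame ε n` together with the BASAL-CROSSING partners (read in `D_{¬ε}`) of the four roots off the basal
  plane; `twinSigs ε h` for a basal slot `h` — bottom sector `{r basal : 0 < ⟪r, h⟫}` read in `D_ε`, top the opposite
  sector read in `D_{¬ε}`; `modelNormals` (the eight unit `{111}` normals of the model lattice, as face normals),
  `planeHexagon n`, `basalHexagon`, `basalSector h`;
* `localSummandA v S₁ S₂ X z` — the summand of `LocalEndRowA` (so that `LocalEndRowA v s_F S₁ S₂ ↔ ∀ X z …, localSummandA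
  … ≤ s_F`, `localEndRowA_iff`);
* `OnSiteAt 𝒰 X z` — the window `X ∩ B̄(z,3)` is a rigid-motion image of a pattern of `𝒰` with the payer at the image
  of the origin; `IsBarlowWindow P` — `P` lies on the sites of one Barlow stacking in model position;
* **`EndRowOnSiteA v s_F 𝒰`** — THE ON-SITE FACT: every pattern of `𝒰` has `localStatSig ≤ s_F` for every row
  signature set (`8` translation rows, `12` twin rows);
* **`EndRowTransTailA v s_F 𝒰`**, **`EndRowTwinTailA v s_F 𝒰`** — THE TAILS: the summand is `≤ s_F` at every payer
  window that is NOT on-site;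
* `barlowWindowUniverse vmax` — U-W(`vmax`) as a set of patterns (lit's enumeration object: `IsHaggSeq` word, sites in
  the closed radius-`3` ball about the payer `0`, at most `vmax` vacancies, at least one in the payer's unit sphere).
WHY SIGNATURES SUFFICE (proved in the sibling files, not here): on a Barlow window every `v2(A)` mover frame has slot
dozen `D₊` or `D₋` (frame lemma), and the admissible classes of ANY plate system form crossing paths on which the only
`D±` dozens are a root node and its basal partner (class collapse); so for every frame `L` the (A)-statistic of the
typed rows at an on-site window is dominated by `localStatSig` of ONE of the `20` signature rows — the reduction
`EndRowOnSiteA ∧ tails ⇒ EndRowTransA ∧ EndRowTwinHalfTurnA` is the bridge file's theorem.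
WHAT THIS IS NOT: no census fact and no tail is proved here; F-C1 not moved.
-/

noncomputable section

namespace Summit.Ventures.Crystal3D.Theorems

open Summit.Ventures.Crystal3D Finset
open Literature.MathematicalPhysics.StatisticalMechanics (basalMirror barlowStacking IsHaggSeq)
open scoped InnerProductSpace

/-! ### Signatures -/

/-- The frame of a signature side: `false ↦` the identity (dozen `D₊ = fccSlots`), `true ↦` the basal model mirror
(dozen `D₋`, the basal twin of `fccSlots`). -/
def sigFrame : Bool → (EuclideanSpace ℝ (Fin 3) ≃ₗᵢ[ℝ] EuclideanSpace ℝ (Fin 3))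
  | false => LinearIsometryEquiv.refl ℝ (EuclideanSpace ℝ (Fin 3))
  | true => basalMirror

/-- The direction of the signature `(ε, w)`: the slot `w` read in the frame of the side `ε`. -/
def sigDir (σ : Bool × EuclideanSpace ℝ (Fin 3)) : EuclideanSpace ℝ (Fin 3) :=
  sigFrame σ.1 σ.2

section Sig

variable (X : Finset (EuclideanSpace ℝ (Fin 3)))

/-- (A)-END PAIR THROUGH A SIGNATURE of `Σ`: `q, b ∈ X`, `b` has two payers, and for some `(ε, w) ∈ Σ` the mover
`q` has its predecessor ball `q − d ∈ X` and end-moves onto `b` in the class `(sigFrame ε, d)`, `d = sigFrame ε w`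
(verbatim `IsEndPairA` with the class witness drawn from `Σ`). -/
def IsEndPairSig (v : WordVersion) (sig : Finset (Bool × EuclideanSpace ℝ (Fin 3))) (b q : EuclideanSpace ℝ (Fin 3)) :
    Prop :=
  q ∈ X ∧ b ∈ X ∧ HasTwoPayers X b ∧ ∃ σ ∈ sig, q - sigDir σ ∈ X ∧ IsEndMove X v (sigFrame σ.1) (sigDir σ) q b

open scoped Classical in
/-- END MULTIPLICITY of `b` through the signatures `Σ`. -/
def endMultSig (v : WordVersion) (sig : Finset (Bool × EuclideanSpace ℝ (Fin 3))) (b : EuclideanSpace ℝ (Fin 3)) : ℕ :=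
  (X.filter fun q => IsEndPairSig X v sig b q).card

open scoped Classical in
/-- THE LOCAL STATISTIC through the signatures `Σ` at the payer `z` (pooling radius `1`): the `LocalEndRowA` summand
with `endMultSig` in place of `endMultA`. -/
def localStatSig (v : WordVersion) (sig : Finset (Bool × EuclideanSpace ℝ (Fin 3))) (z : EuclideanSpace ℝ (Fin 3)) : ℝ :=
  ∑ b ∈ X.filter (fun b => dist z b ≤ 1 ∧ 0 < endMultSig X v sig b), (endMultSig X v sig b : ℝ) / pooledDef X b

end Sig

/-! ### The row signature sets -/

/-- The eight unit `{111}` normals of the model lattice: the normalised sums of the `60°` slot triangles (faces). -/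
def modelNormals : Finset (EuclideanSpace ℝ (Fin 3)) :=
  (((fccSlots ×ˢ fccSlots) ×ˢ fccSlots).filter fun t =>
      ⟪t.1.1, t.1.2⟫_ℝ = 1 / 2 ∧ ⟪t.1.1, t.2⟫_ℝ = 1 / 2 ∧ ⟪t.1.2, t.2⟫_ℝ = 1 / 2).image
    fun t => (Real.sqrt 6)⁻¹ • (t.1.1 + t.1.2 + t.2)

/-- The six model slots in the `{111}` plane with normal `n`. -/
def planeHexagon (n : EuclideanSpace ℝ (Fin 3)) : Finset (EuclideanSpace ℝ (Fin 3)) :=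
  fccSlots.filter fun w => ⟪w, n⟫_ℝ = 0

/-- The six BASAL model slots (third coordinate `0`). -/
def basalHexagon : Finset (EuclideanSpace ℝ (Fin 3)) :=
  fccSlots.filter fun w => w 2 = 0

/-- The basal SECTOR of `h`: the basal slots at a positive inner product with `h` (for a basal slot `h`: the three
consecutive slots centred at `h`). -/
def basalSector (h : EuclideanSpace ℝ (Fin 3)) : Finset (EuclideanSpace ℝ (Fin 3)) :=
  basalHexagon.filter fun r => 0 < ⟪r, h⟫_ℝ

open scoped Classical in
/-- **TRANSLATION ROW SIGNATURES** `transSigs ε n`: the six root classes `(ε, w)`, `w` in the hexagon of the model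
plane `n`, together with the basal-crossing partners `(¬ε, w)` of the roots off the basal plane (a root `d` of `D_ε`
crossing the basal plane continues, after the crossing, in the class of dozen `D_{¬ε}` and direction `−M_b d`; as a
set of model slots the partner directions of the `±`-symmetric hexagon are the same four slots). -/
def transSigs (ε : Bool) (n : EuclideanSpace ℝ (Fin 3)) : Finset (Bool × EuclideanSpace ℝ (Fin 3)) :=
  (planeHexagon n).image (fun w => (ε, w)) ∪ ((planeHexagon n).filter fun w => w 2 ≠ 0).image fun w => (!ε, w)

open scoped Classical in
/-- **TWIN ROW SIGNATURES** `twinSigs ε h`: bottom plate read in `D_ε` with the rising basal sector of `h` as roots,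
top plate read in `D_{¬ε}` with the opposite sector. -/
def twinSigs (ε : Bool) (h : EuclideanSpace ℝ (Fin 3)) : Finset (Bool × EuclideanSpace ℝ (Fin 3)) :=
  (basalSector h).image (fun w => (ε, w)) ∪ (basalSector h).image fun w => (!ε, -w)

/-! ### The summand of the typed (A) row, on-site windows, the on-site fact and the tails -/

open scoped Classical in
/-- The SUMMAND of `LocalEndRowA v · S₁ S₂` at the payer `z` of `X`. -/
def localSummandA (v : WordVersion) (S₁ S₂ : PlateSystem) (X : Finset (EuclideanSpace ℝ (Fin 3)))
    (z : EuclideanSpace ℝ (Fin 3)) : ℝ :=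
  ∑ b ∈ X.filter (fun b => dist z b ≤ 1 ∧ 0 < endMultA X v S₁ S₂ b), (endMultA X v S₁ S₂ b : ℝ) / pooledDef X b

open scoped Classical in
/-- `LocalEndRowA` is «the summand is `≤ s_F` at every payer of every `1`-separated configuration». -/
theorem localEndRowA_iff (v : WordVersion) (sF : ℝ) (S₁ S₂ : PlateSystem) :
    LocalEndRowA v sF S₁ S₂ ↔
      ∀ X : Finset (EuclideanSpace ℝ (Fin 3)), (∀ p ∈ X, ∀ q ∈ X, p ≠ q → 1 ≤ dist p q) →
        ∀ z ∈ X, (X.filter fun q => dist z q = 1).card ≤ 11 → localSummandA v S₁ S₂ X z ≤ sF :=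
  Iff.rfl

open scoped Classical in
/-- **ON-SITE WINDOW.**  The payer window `X ∩ B̄(z, 3)` (closed ball) is the image of a pattern `P ∈ 𝒰` under a rigid
motion `x ↦ S x + z` taking the pattern's payer `0` to `z`. -/
def OnSiteAt (𝒰 : Set (Finset (EuclideanSpace ℝ (Fin 3)))) (X : Finset (EuclideanSpace ℝ (Fin 3)))
    (z : EuclideanSpace ℝ (Fin 3)) : Prop :=
  ∃ P ∈ 𝒰, ∃ S : EuclideanSpace ℝ (Fin 3) ≃ₗᵢ[ℝ] EuclideanSpace ℝ (Fin 3),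
    X.filter (fun x => dist z x ≤ 3) = P.image fun p => S p + z

/-- **BARLOW WINDOW.**  The pattern lies on the sites of one Barlow stacking in model position (in-layer spacing `1`,
ideal layer spacing `√(2/3)`, any Hägg sequence). -/
def IsBarlowWindow (P : Finset (EuclideanSpace ℝ (Fin 3))) : Prop :=
  ∃ s : ℤ → ℤ, IsHaggSeq s ∧ (↑P : Set (EuclideanSpace ℝ (Fin 3))) ⊆ barlowStacking 1 (Real.sqrt (2 / 3)) s

open scoped Classical in
/-- **THE UNIVERSE U-W(`vmax`)** (PREREG-F-CERT §2): the patterns `P = sites ∖ V` where the sites are those of a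
Barlow stacking (Hägg word `s`) in the CLOSED ball of radius `3` about the payer `0`, the vacancy set `V ⊆ sites` has
at most `vmax` elements, and the payer is deficient (`deg 0 ≤ 11`). -/
def barlowWindowUniverse (vmax : ℕ) : Set (Finset (EuclideanSpace ℝ (Fin 3))) :=
  {P | ∃ s : ℤ → ℤ, IsHaggSeq s ∧ ∃ V : Finset (EuclideanSpace ℝ (Fin 3)), V.card ≤ vmax ∧
    (↑V : Set (EuclideanSpace ℝ (Fin 3))) ⊆ barlowStacking 1 (Real.sqrt (2 / 3)) s ∧
    (↑P : Set (EuclideanSpace ℝ (Fin 3))) =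
      (barlowStacking 1 (Real.sqrt (2 / 3)) s ∩ Metric.closedBall 0 3) \ ↑V ∧
    (0 : EuclideanSpace ℝ (Fin 3)) ∈ P ∧ (P.filter fun q => dist (0 : EuclideanSpace ℝ (Fin 3)) q = 1).card ≤ 11}

/-- Every pattern of U-W is a Barlow window. -/
theorem isBarlowWindow_of_mem_barlowWindowUniverse {vmax : ℕ} {P : Finset (EuclideanSpace ℝ (Fin 3))}
    (h : P ∈ barlowWindowUniverse vmax) : IsBarlowWindow P := by
  obtain ⟨s, hs, V, -, -, hP, -, -⟩ := h
  exact ⟨s, hs, by rw [hP]; exact fun x hx => hx.1.1⟩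

/-- **THE ON-SITE FACT** for the universe `𝒰` at version `v` and constant `s_F`: every pattern has local statistic
`≤ s_F` at its payer `0` for each of the `8` translation and `12` twin row signature sets.  (The certificate target is
`EndRowOnSiteA WordVersion.v2 (9/2) (barlowWindowUniverse 4)`.) -/
def EndRowOnSiteA (v : WordVersion) (sF : ℝ) (𝒰 : Set (Finset (EuclideanSpace ℝ (Fin 3)))) : Prop :=
  ∀ P ∈ 𝒰,
    (∀ ε : Bool, ∀ n ∈ modelNormals, localStatSig P v (transSigs ε n) 0 ≤ sF) ∧
    (∀ ε : Bool, ∀ h ∈ basalHexagon, localStatSig P v (twinSigs ε h) 0 ≤ sF)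

open scoped Classical in
/-- **THE TRANSLATION TAIL**: at every payer window that is NOT on-site for `𝒰`, the summand of the typed translation
row is `≤ s_F`, for every frame. -/
def EndRowTransTailA (v : WordVersion) (sF : ℝ) (𝒰 : Set (Finset (EuclideanSpace ℝ (Fin 3)))) : Prop :=
  ∀ L : EuclideanSpace ℝ (Fin 3) ≃ₗᵢ[ℝ] EuclideanSpace ℝ (Fin 3),
  ∀ X : Finset (EuclideanSpace ℝ (Fin 3)), (∀ p ∈ X, ∀ q ∈ X, p ≠ q → 1 ≤ dist p q) →
  ∀ z ∈ X, (X.filter fun q => dist z q = 1).card ≤ 11 → ¬ OnSiteAt 𝒰 X z →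
    localSummandA v ⟨L, inPlaneRoots L 1⟩ ⟨L, inPlaneRoots L (-1)⟩ X z ≤ sF

open scoped Classical in
/-- **THE TWIN TAIL** (half-turn form): the same for the typed twin row. -/
def EndRowTwinTailA (v : WordVersion) (sF : ℝ) (𝒰 : Set (Finset (EuclideanSpace ℝ (Fin 3)))) : Prop :=
  ∀ L : EuclideanSpace ℝ (Fin 3) ≃ₗᵢ[ℝ] EuclideanSpace ℝ (Fin 3),
  ∀ X : Finset (EuclideanSpace ℝ (Fin 3)), (∀ p ∈ X, ∀ q ∈ X, p ≠ q → 1 ≤ dist p q) →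
  ∀ z ∈ X, (X.filter fun q => dist z q = 1).card ≤ 11 → ¬ OnSiteAt 𝒰 X z →
    localSummandA v ⟨L, inPlaneRoots L 1⟩
      ⟨((ℝ ∙ EuclideanSpace.single (2 : Fin 3) (1 : ℝ)).reflection).trans L,
        inPlaneRoots (((ℝ ∙ EuclideanSpace.single (2 : Fin 3) (1 : ℝ)).reflection).trans L) (-1)⟩ X z ≤ sF

/-! ### Sanity: the decomposition is a case split (the on-site case is the bridge file's theorem) -/

open scoped Classical in
/-- **The reduction, translation row**: if the summand is `≤ s_F` at every ON-SITE payer window (the bridge from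
`EndRowOnSiteA`, proved elsewhere) and at every other payer window (the tail), the typed row holds. -/
theorem endRowTransA_of_onSite_of_tail {v : WordVersion} {sF : ℝ} (𝒰 : Set (Finset (EuclideanSpace ℝ (Fin 3))))
    (hon : ∀ L : EuclideanSpace ℝ (Fin 3) ≃ₗᵢ[ℝ] EuclideanSpace ℝ (Fin 3),
      ∀ X : Finset (EuclideanSpace ℝ (Fin 3)), (∀ p ∈ X, ∀ q ∈ X, p ≠ q → 1 ≤ dist p q) →
      ∀ z ∈ X, (X.filter fun q => dist z q = 1).card ≤ 11 → OnSiteAt 𝒰 X z →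
        localSummandA v ⟨L, inPlaneRoots L 1⟩ ⟨L, inPlaneRoots L (-1)⟩ X z ≤ sF)
    (htail : EndRowTransTailA v sF 𝒰) : EndRowTransA v sF := by
  intro L X hX z hz hz11
  by_cases h : OnSiteAt 𝒰 X z
  · exact hon L X hX z hz hz11 h
  · exact htail L X hX z hz hz11 h

open scoped Classical in
/-- **The reduction, twin row** (half-turn form). -/
theorem endRowTwinHalfTurnA_of_onSite_of_tail {v : WordVersion} {sF : ℝ}
    (𝒰 : Set (Finset (EuclideanSpace ℝ (Fin 3))))
    (hon : ∀ L : EuclideanSpace ℝ (Fin 3) ≃ₗᵢ[ℝ] EuclideanSpace ℝ (Fin 3),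
      ∀ X : Finset (EuclideanSpace ℝ (Fin 3)), (∀ p ∈ X, ∀ q ∈ X, p ≠ q → 1 ≤ dist p q) →
      ∀ z ∈ X, (X.filter fun q => dist z q = 1).card ≤ 11 → OnSiteAt 𝒰 X z →
        localSummandA v ⟨L, inPlaneRoots L 1⟩
          ⟨((ℝ ∙ EuclideanSpace.single (2 : Fin 3) (1 : ℝ)).reflection).trans L,
            inPlaneRoots (((ℝ ∙ EuclideanSpace.single (2 : Fin 3) (1 : ℝ)).reflection).trans L) (-1)⟩ X z ≤ sF)
    (htail : EndRowTwinTailA v sF 𝒰) : EndRowTwinHalfTurnA v sF := by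
  intro L X hX z hz hz11
  by_cases h : OnSiteAt 𝒰 X z
  · exact hon L X hX z hz hz11 h
  · exact htail L X hX z hz hz11 h

end Summit.Ventures.Crystal3D.Theorems

end
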